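import Mathlib
import Summits.Ventures.PercRepro2.HCov
import Summits.Ventures.PercRepro2.HCovSwap
import Summits.Ventures.PercRepro2.A3RootEdge
import Summits.Ventures.PercRepro2.A3RootEdgeMain
import Summits.Ventures.PercRepro2.A3RootEdgeAll
import Summits.Ventures.PercRepro2.EdgeCubic
import Summits.Ventures.PercRepro2.RootEdgeBern

/-!
# The Bernstein coefficients are symmetric in the two roots; row 2′CPOLAR at EVERY root edge
(blind cell PercRepro2, p5 g14; `proofs/P5-OEDGE.md` §11)

`B1`, `B2` are polarisations of the cubic form `GcPoly` in the twelve pattern masses; under the root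
swap `a₁ ↔ a₂` the masses transform exactly as in `Gc_swap` (`Q`, `PD` invariant, the odd `σ`-moments
and `gap` change sign), so **`B1_swap`**, **`B2_swap`**.  With RootEdgeBern.lean this gives the
Bernstein positivity at the `a₂`-root edges too (`B2_nonneg_root_right`, `B1_nonneg_root_right`)
and at any root edge in either orientation (`B2_nonneg_of_isRootEdge`, `B1_nonneg_of_isRootEdge`):
row 2′CPOLAR holds at every a₃–root edge, given (HCOV) on `G − e` for the `b₁` coefficient.
-/

namespace Summit.Ventures.PercRepro2

open UnionCluster

namespace CovForm

namespace EdgeLine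

section Swap

variable {V : Type*} {E : Type*} [Fintype E] [DecidableEq E] {R : Type*} [Field R] [LinearOrder R]

omit [LinearOrder R] in
/-- `B1` is symmetric in the two roots. -/
theorem B1_swap (p : E → R) (ends : E → Sym2 V) (o a₁ a₂ a₃ b : V) (e : E) :
    B1 p ends o a₂ a₁ a₃ b e = B1 p ends o a₁ a₂ a₃ b e := by
  unfold B1 B1Poly polar1 EQbo EQb3 EQb3o EQo EQ3 EQ3o PDb PDbo Do gap
  rw [avoidAll_root_swap, PDEvent_root_swap]
  ring

omit [LinearOrder R] in
/-- `B2` is symmetric in the two roots. -/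
theorem B2_swap (p : E → R) (ends : E → Sym2 V) (o a₁ a₂ a₃ b : V) (e : E) :
    B2 p ends o a₂ a₁ a₃ b e = B2 p ends o a₁ a₂ a₃ b e := by
  unfold B2 B2Poly polar2 EQbo EQb3 EQb3o EQo EQ3 EQ3o PDb PDbo Do gap
  rw [avoidAll_root_swap, PDEvent_root_swap]
  ring

end Swap

end EdgeLine

namespace RootEdge

open EdgeLine

section Both

variable {V : Type*} {E : Type*} [Fintype V] [DecidableEq V] [Fintype E] [DecidableEq E]
  {R : Type*} [Field R] [LinearOrder R] [IsStrictOrderedRing R]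

/-- `0 ≤ B2` at an `a₂`-root edge (the root swap of `B2_nonneg_root`). -/
theorem B2_nonneg_root_right (p : E → R) (hp : IsProbVec p) (ends : E → Sym2 V) (o a₁ a₂ a₃ b : V)
    (e : E) (hends : ends e = s(a₂, a₃)) : 0 ≤ B2 p ends o a₁ a₂ a₃ b e := by
  rw [← B2_swap]
  exact B2_nonneg_root p hp hends o a₁ b

/-- `0 ≤ B1` at an `a₂`-root edge given (HCOV) at `p[e↦0]` (the root swap of `B1_nonneg_root`). -/
theorem B1_nonneg_root_right (p : E → R) (hp : IsProbVec p) (ends : E → Sym2 V) (o a₁ a₂ a₃ b : V)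
    (e : E) (hends : ends e = s(a₂, a₃)) (h₀ : HCov (Function.update p e 0) ends o a₁ a₂ a₃ b) :
    0 ≤ B1 p ends o a₁ a₂ a₃ b e := by
  rw [← B1_swap]
  exact B1_nonneg_root p hp hends o a₁ b ((HCov_swap _ ends o a₁ a₂ a₃ b).2 h₀)

/-- **`0 ≤ B2` at every root edge at `a₃`** (either root, either orientation), unconditionally. -/
theorem B2_nonneg_of_isRootEdge (p : E → R) (hp : IsProbVec p) (ends : E → Sym2 V)
    (o a₁ a₂ a₃ b : V) (e : E) (he : IsRootEdge ends a₁ a₂ a₃ e) :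
    0 ≤ B2 p ends o a₁ a₂ a₃ b e := by
  rcases he with h | h | h | h
  · exact B2_nonneg_root p hp h o a₂ b
  · exact B2_nonneg_root p hp (by rw [h, Sym2.eq_swap]) o a₂ b
  · exact B2_nonneg_root_right p hp ends o a₁ a₂ a₃ b e h
  · exact B2_nonneg_root_right p hp ends o a₁ a₂ a₃ b e (by rw [h, Sym2.eq_swap])

/-- **`0 ≤ B1` at every root edge at `a₃`**, given (HCOV) at `p[e↦0]`. -/
theorem B1_nonneg_of_isRootEdge (p : E → R) (hp : IsProbVec p) (ends : E → Sym2 V)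
    (o a₁ a₂ a₃ b : V) (e : E) (he : IsRootEdge ends a₁ a₂ a₃ e)
    (h₀ : HCov (Function.update p e 0) ends o a₁ a₂ a₃ b) : 0 ≤ B1 p ends o a₁ a₂ a₃ b e := by
  rcases he with h | h | h | h
  · exact B1_nonneg_root p hp h o a₂ b h₀
  · exact B1_nonneg_root p hp (by rw [h, Sym2.eq_swap]) o a₂ b h₀
  · exact B1_nonneg_root_right p hp ends o a₁ a₂ a₃ b e h h₀
  · exact B1_nonneg_root_right p hp ends o a₁ a₂ a₃ b e (by rw [h, Sym2.eq_swap]) h₀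

end Both

end RootEdge

end CovForm

end Summit.Ventures.PercRepro2
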